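import Summits.BirchSwinnertonDyer.BirchSwinnertonDyer.Theorems.PrintX9MuPartStubH5bAtSZeroP
import Literature.NumberTheory.EllipticCurves.ZpExtensionEisensteinSelmerH5bOrdinaryAnomalousProofs
import HarnessLib

/-!
# `stub_h5bAtSZeroP : Stmt.h5bAtSZeroP` — the registered H.5(b) stub of the shared deciding μ-crux μP-CG, CLOSED

Summits-side file for the line `spec_witnesses` on μP-CG `MuInequalityCoherentPairOfPrintCG` (stmt-BirchSwinnertonDyer-23428;
skeleton v8 of μ-LEAD `bsd-line-x9-p1` g4, registered stub `stub_h5bAtSZeroP : Stmt.h5bAtSZeroP`); cell `pub/bsd-print-x9`, seat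
`bsd-line-x10b-p1-w8` g3 (assembler of the stub per v8).  `--supports` stmt-BirchSwinnertonDyer-23428 (stub credit).

The letter `Stmt.h5bAtSZeroP` (registered text; = the hypothesis `H5P` of `HeegnerMuPartH5bAtS.h5bAtS_of_clauseZeroP`, p670626)
is re-homed here VERBATIM as an `abbrev` so that the gate's by-name stub header matches (precedent p606505), and PROVED:
* **`stub_h5bAtSZeroP`** := `HeegnerMuPartH5bAtS.h5bAtSZeroP_of_clauseP` (the frame packaging, p674325) applied to road U's
  threshold-explicit clause `WeierstrassCurve.eisensteinDVRSetting_h5b_clause_zero_of_mem_p` (x9-p1-w3 g6, F7b: Howard's H.5(b)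
  at a place above `p`, tower level `0`, for the curve's Eisenstein setting, WITHOUT non-anomalous hypotheses — the uniform
  Iwasawa-involution road: F1/F2 torsion cut, F3 π-adic plus parts, F4 exponents (x10b-p1-w5 g3), F1b kernel lifts (x10b-p1-w6 g3),
  F5 residual-involution transport, F7a readout).
With v8's in-file derivations (`stub_h5bAtS := h5bAtSERed_of_clauseZeroP stub_h5bAtSZeroP`, p672403) Howard's H.5(b) input of
STUB A is thereby discharged on every `Thm413Hypotheses` frame.  HONEST FRAMING: this closes ONE registered stub of the skeleton;
`stub_exactAtP`, `stub_readoutSelmer`, `stub_readoutIndex` remain; no summit statement is proved; the μ-crux is not asserted;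
BSD is not proved by any of this.

References: [Howard2004HeegnerKolyvagin] §1.3 H.5(b), §1.6, §2.2, Def. 3.1.2, §3.1 (arXiv:1202.6340 p. 7 L96–97, p. 11–16);
[CastellaGrossiLeeSkinner2022] §3.2, §3.4; [Brink2007] Thm. 2, Cor. 1; [GreenbergLNM1716] §2; [MazurRubinMemoirs2004] Def. 1.1.1.
-/

set_option linter.dupNamespace false
set_option autoImplicit false

noncomputable section

open scoped Classical Pointwise ContRepresentation TensorProduct NumberField

open Function NumberField IsDedekindDomain Field
open Literature Literature.NumberTheory.EllipticCurves WeierstrassCurve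
open Literature.NumberTheory.GaloisCohomology Literature.NumberTheory.GaloisCohomology.Howard2004
open Literature.NumberTheory.Automorphic
open Literature.NumberTheory.GaloisRepresentations Literature.NumberTheory.GaloisRepresentations.DiscreteGaloisModule
open Summit.BirchSwinnertonDyer.BirchSwinnertonDyer.Theorems

namespace Summit.BirchSwinnertonDyer.BirchSwinnertonDyer.Theorems.HeegnerMuPartH5bAtS

set_option synthInstance.maxHeartbeats 80000 in
/-- **The letter of the registered stub `stub_h5bAtSZeroP`** (skeleton v8 on stmt-BirchSwinnertonDyer-23428, VERBATIM): Howard's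
H.5(b) clause for the curve's Eisenstein setting on the frames of the μ-letter at ONE place `v ∈ S` above `p`, tower level `0`,
with a threshold `m₁` per `(frame, v)` before all the data of the canonical setting.  (A crux-skeleton LETTER, not a literature
fact: no citation tag on purpose — the registered text lives in `Cruxes/…/Lines/spec_witnesses.lean`, which is not importable.) -/
abbrev Stmt.h5bAtSZeroP : Prop :=
  ∀ (N : ℕ) [NeZero N] (W : WeierstrassCurve ℚ) [W.IsGloballyMinimal] (K : Type) [Field K] [NumberField K]
    (p : ℕ) [Fact p.Prime] (κ : ZpExtension K p) (γ : Field.absoluteGaloisGroup K)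
    (hyp : CastellaGrossiLeeSkinner2022.Thm413Hypotheses N W K p κ γ),
    W.HasIrreducibleModPGaloisRep p → (W.baseChange K).HasIrreducibleModPGaloisRep p →
    haveI := hyp.isElliptic
    ∀ (S : Finset (HeightOneSpectrum (𝓞 K)))
      (hpS : ∀ v, ((p : ℕ) : 𝓞 K) ∈ v.asIdeal → v ∈ S)
      (hbad : ∀ v, v ∉ S → ((p : ℕ) : 𝓞 K) ∉ v.asIdeal → (W.baseChange K).HasGoodReductionAt v),
    (∀ v ∈ S, ((p : ℕ) : 𝓞 K) ∈ v.asIdeal ∨ ((N : ℕ) : 𝓞 K) ∈ v.asIdeal) →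
    (∀ (σ : K ≃ₐ[ℚ] K) (v : HeightOneSpectrum (𝓞 K)), σ • v ∈ S → v ∈ S) →
    ∀ v ∈ S, ((p : ℕ) : 𝓞 K) ∈ v.asIdeal →
    ∃ m₁ : ℕ, ∀ (m : ℕ) (hm : 1 ≤ m), m₁ < m →
      letI := IwasawaAlgebra.isDomain_quotient_X_pow_add_C p hm
      letI := IwasawaAlgebra.isDiscreteValuationRing_quotient_X_pow_add_C p hm
      haveI := IwasawaAlgebra.EisensteinCoeff.isLocalRing_succ p hm
      letI := IwasawaAlgebra.EisensteinCoeff.algebraOfSpecSucc p m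
      haveI := W.isScalarTower_algebraOfSpecSucc (K := K) (p := p) (m := m)
      letI := W.residueModuleSucc (K := K) (p := p) hm
      ∀ (π : ∀ v : HeightOneSpectrum (𝓞 K), TamePin v) (L : Set (HeightOneSpectrum (𝓞 K)))
        (hL : L ⊆ (W.eisensteinTower (κ.unitTwist (-1)) hm).degreeTwoPrimes p) (hLS : ∀ v ∈ L, v ∉ S)
        (jbar' : AlgebraicClosure K →+* ℂ)
        (c₀ : absoluteGaloisGroup ℚ) (σ : K ≃ₐ[ℚ] K) (hσ₁ : σ ≠ 1) (hσ : σ * σ = 1)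
        (hτl : IsLiftOfAut σ (absGaloisTransport (K := ℚ) (L := K) c₀).toRingEquiv)
        (hτ₂ : Function.Involutive (absGaloisTransport (K := ℚ) (L := K) c₀).toRingEquiv)
        (D : ∀ k, DualityDatum p (ConjugationDatum.ofLifts σ hσ₁ hσ _ hτl hτ₂)
          ((W.eisensteinTower (κ.unitTwist (-1)) hm).ρ k) (IwasawaAlgebra.EisensteinCoeff p m (k + 1)))
        (e : ∀ j : ℕ, geomTorsion (W.baseChange K) ((p : ℤ) ^ j) →+ geomTorsion (W.baseChange K) ((p : ℤ) ^ j) →+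
          MuCarrier K (p ^ j))
        (log : ∀ j : ℕ, MuCarrier K (p ^ j) →+ ZMod (p ^ j)),
        IsComplexConjugation (Rat.castHom ℝ) c₀ →
        (∀ x, (ConjugationDatum.ofLifts σ hσ₁ hσ _ hτl hτ₂).τ x = absGaloisTransport (K := ℚ) (L := K) c₀ x) →
        (∀ k, (D k).e = ZpExtension.eisensteinDualityForm hm (k + 1)
          (conjPairing (e (k + 1)) ((ConjugationDatum.ofLifts σ hσ₁ hσ _ hτl hτ₂).isLift.torsionMap W _)
            (log (k + 1)))) →
        (∀ j a, e j a a = 0) →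
        (∀ j (g : absoluteGaloisGroup K) a b, e j (g • a) (g • b) = mu K (p ^ j) g (e j a b)) →
        (∀ j a b, e j ((ConjugationDatum.ofLifts σ hσ₁ hσ _ hτl hτ₂).isLift.torsionMap W _ a)
          ((ConjugationDatum.ofLifts σ hσ₁ hσ _ hτl hτ₂).isLift.torsionMap W _ b) = -e j a b) →
        (∀ j (a : geomTorsion (W.baseChange K) ((p : ℤ) ^ j)),
          (ConjugationDatum.ofLifts σ hσ₁ hσ _ hτl hτ₂).isLift.torsionMap W _
            ((ConjugationDatum.ofLifts σ hσ₁ hσ _ hτl hτ₂).isLift.torsionMap W _ a) = a) →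
        (∀ j, Function.Bijective (log j)) →
        (∀ j (g : absoluteGaloisGroup K) ξ, log j (mu K (p ^ j) g ξ) = cyclotomicCharacterModPow K p j g * log j ξ) →
          (((W.isQuotientBy_eisensteinDVRSetting_πbar (κ.unitTwist (-1)) hm S hpS hbad L hL hLS jbar'
              (ConjugationDatum.ofLifts σ hσ₁ hσ _ hτl hτ₂) D
              (W.eisensteinLevelsTameFs (κ.unitTwist (-1)) hm π S hpS hbad L hL hLS)
              0).propagateStructure (W.eisensteinTowerTriple (κ.unitTwist (-1)) hm S hpS hbad L hL hLS 0).cond)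
              (Sum.inr (σ • v))).map
              (((W.residualTauGeomTorsion (p := p) (ConjugationDatum.ofLifts σ hσ₁ hσ _ hτl hτ₂) hm (k := 0 + 1)
                  (Nat.succ_pos 0)).thetaH1 (Sum.inr v)).comp
                ((ConjugationDatum.ofLifts σ hσ₁ hσ _ hτl hτ₂).transportH1
                  ((W.baseChange K).torsionGaloisModule (p : ℤ)) v)) =
            ((W.isQuotientBy_eisensteinDVRSetting_πbar (κ.unitTwist (-1)) hm S hpS hbad L hL hLS jbar'
              (ConjugationDatum.ofLifts σ hσ₁ hσ _ hτl hτ₂) D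
              (W.eisensteinLevelsTameFs (κ.unitTwist (-1)) hm π S hpS hbad L hL hLS)
              0).propagateStructure (W.eisensteinTowerTriple (κ.unitTwist (-1)) hm S hpS hbad L hL hLS 0).cond)
              (Sum.inr v)

set_option synthInstance.maxHeartbeats 80000 in
/-- **`stub_h5bAtSZeroP` CLOSED**: the registered H.5(b) stub of skeleton v8, by the frame packaging `h5bAtSZeroP_of_clauseP`
(p674325) of road U's clause `WeierstrassCurve.eisensteinDVRSetting_h5b_clause_zero_of_mem_p` (x9-p1-w3 g6).
[cite: Howard2004HeegnerKolyvagin, §1.3 H.5(b), §2.2, Def. 3.1.2, §3.1 (arXiv:1202.6340 p. 7 L96–97, p. 15–16)]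
[cite: CastellaGrossiLeeSkinner2022, §3.2 and §3.4] [cite: Brink2007, Thm. 2 and Cor. 1] -/
theorem stub_h5bAtSZeroP : Stmt.h5bAtSZeroP :=
  h5bAtSZeroP_of_clauseP (by
    intro K _ _ W _ p _ κ m hm S hpS hbad L hL hLS jbar σ hσ₁ hσ τ hτ hτ₂ D fs v hpv hpσv hgood hord hanti s g hg hms
    exact W.eisensteinDVRSetting_h5b_clause_zero_of_mem_p κ hm S hpS hbad L hL hLS jbar σ hσ₁ hσ τ hτ hτ₂ D fs hpv hpσv
      hgood hord hanti hg hms)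

end Summit.BirchSwinnertonDyer.BirchSwinnertonDyer.Theorems.HeegnerMuPartH5bAtS

end
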